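import Summits.QuantumFields.BalabanUV.T4Continuum.Support.NE9SizeFedCouplingSpeciesReadOut
import Summits.QuantumFields.BalabanUV.T4Continuum.Support.NE9CurveFromBackgroundMapAdditive

/-!
# NE9CurveFromBackgroundMapSpeciesEnd — the ASSEMBLED-SPECIES END (curve ⊕ kernel channel, leaf A3 produced size-fed) FOR CURVES
# OF BAŁABAN'S SHAPE `σ′ ↦ Φ_X(σ′ • B)` with EVERY slice-curve binder PRODUCED: `CurData.Admissible`, crew row (w19)'s additivity and
# leaf A3's (c1)–(c3), all from RAY-species binders on the shift field and the background-map TYPE facts (Φ1)–(Φ3) (cell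
# `pub-balaban`, T4-DAG §2 node U3 ∕ §6 NE9; NE9 formalisation swarm, unit `b2b-balaban-t4-ne9-formalise-leaf-06` gen 9;
# own-initiative micro-item «END-COMP-SPECIES», CLAIMS.log l.11931 — the species-level twin of this lineage's END-COMP (p215920),
# named as «possible next» by leaf-05-g6 ∕ leaf-01-g7 at their seat closings; at own risk)

HONEST FRAMING (T4-DAG PAGE 1).  Rung (B)+1 of the FINITE-VOLUME T⁴ programme — existence AND uniqueness of the ε → 0 limit
of gauge-invariant observables on a fixed torus; NOT infinite volume, NOT a mass gap, NOT the Clay problem.  NE9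
(`T4OutputRate.NE9` ∧ `FadingMemory`) is a cell NEW ESTIMATE, NOT PRINTED, and is NOT discharged here («NE9 ⇐ the named
binders»); spine 0∕9; 0∕18 skeleton leaves instantiated on Bałaban's objects (O-NE9-1).  HONEST DEPENDENCY (cell line,
verbatim): continuum YM on T⁴ ⇐ BetaPertH ∧ nine spine estimates (0/9 proved); BetaPertH ⇐ (D1) ∧ (D4) ∧ CAP+tail; G-an2-4
gates asym, D1 and NE2/3/4.  [I] = [Balaban1987RG1] (CMP **109**), [II] = [Balaban1988RG2Cluster] (CMP **116**) are quoted for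
TYPES only (ABSOLUTE RULE: nothing printed in the audited series is asserted).  No `def`, no Prop-valued definition;
`FlowStep.BetaPertH`, (B), (B^μ) do not occur.

WHERE THIS SITS.  The row owner's assembled-species END `NE9Lemma1SpeciesEnd.termSize_ne9_and_fadingMemory_species_compProj`
(t4-ne9-p1 g25, p215007) is the NE9 END face at the FULL species channel of [I] §§3–4, 𝒯 = cpieceChannel D.toC + cpieceChannel K.toC
(species (a): the fifth-order terms along the analytic slice CURVES of [I] Lemma 4 (3.53)∕(3.54) — located correction O-ne9p1g25-1;
species (b): [I] §4's point-localized kernels (4.20)–(4.30)); leaf-05-g6's A3-FED-SPECIES (p215986 ∕ read-out twin p216114) PRODUCED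
its last channel binder, leaf A3's coupling modulus, size-fed.  Those two faces hold for a GENERIC curve datum `D : CurData` and
display on the curve side `D.Admissible`, (w19)'s `PieceAdditiveOn (analyticClass D.R) D.toC` and leaf A3's slice-curve binders
(c1) `hcont` ∕ (c2) `hlip` ∕ (c3) `hroom`.  For curves OF BAŁABAN'S SHAPE — leaf-05-g5's composite datum `RemData.compCur Dd Φ R′`
(CUR-BG p215194: the ray `τ ↦ τ • B` in the shift field `B = Dd.dir … t s σ` of [II] (1.1)∕(1.23) composed with the background map
`Φ_X : B ↦ (chart of) U_j(□₀, exp iB)|_X` of [I] (3.30)∕(3.37); written `Φ` because the faces' representation functional is `Ψ`) —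
every one of those five curve-side binders is PRODUCED by a landed lemma: `admissible_compCur`, `cont_compCur`, `lip_compCur`,
`room_compCur` (CUR-BG) and `pieceAdditiveOn_compCur` (this lineage's CUR-COMP-S3 p215585, through (w19) p215330).  THIS FILE
applies p215986's (A) and p216114's (B) at `D := Dd.compCur Φ R′` with the five producers — exactly what this lineage's END-COMP
(p215920) did for the curve-only END-M face p214812.
BINDER DIFF vs (A)∕(B) (mechanical): GONE = `hD`, `hAa`, `hcont`, `hlip`, `hroom` (curve level); ADDED = the RAY datum's
`hDd : Dd.Admissible ℓ c_dir d₀` ([II] (1.22)–(1.25) TYPE), `hpos0 : 0 < dirB`, (w16)'s GLOBAL `hdirC` and the global size `hdirB`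
(everywhere form of `dir_le`), A3-REM's ray-level (d1) contour continuity `hcont` and (d2) coupling-Lipschitz modulus
`clipd·(c_dir·ℓ·R_X)` `hlip` (TYPE [II] (1.21)), `0 ≤ clipd`, and the background-map TYPE facts (Φ1) `hΦan` analytic on the field
ball ([I] (3.37)), (Φ2) `hΦmaps` into the chart ball of radius `R′_X` ([I] Lemma 4 (3.53)), (Φ3) `hΦ0 : Φ_X 0 = 0`; every other
binder is (A)'s ∕ (B)'s with `D ↦ Dd.compCur Φ R′` textually — the kernel species' `hK hκ₁ hR hdY hLb hAb hlam hkerC hkerL`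
(A3-KER's (C)∕(K-Lip) VERBATIM), `MF ⊆ analyticClass R′`, the projection quadruple (A) ∕ the RO–AW binders (B), A1∕A2 `hCup`,
R1∕KP∕box∕(XZ)∕(B0)∕(N′), `N j ≤ N̄`, `ω < 1`.  Conclusions LITERALLY (A)'s ∕ (B)'s with **`clipa := 4·clipd`** (CUR-BG's Lipschitz
transfer through Φ; it enters only the displayed scalar `hqTb`, `qTbar` symbolic, c6).
NET: on the row's most complete END the located correction (rays ↦ curves of Bałaban's shape) costs EXACTLY (Φ1)–(Φ3) on the
background map and the GLOBAL forms of two ray binders; no curve-level hypothesis survives; the kernel side is untouched.  NOT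
PRINTED and not claimed: that Bałaban's 𝐇_k, U_j(□₀, exp iB), U^c_j and the (4.21)∕(4.25)∕(4.29)∕(4.30)-kernels meet the ray ∕ Φ ∕
(K)∕(C)∕(K-Lip) binders (O-NE9-1 ∕ O-NE9-5).  DISGUISE TEST: last coupling, one input family, two species, size first — leaf-A3 ∕
END-face bookkeeping, not NE9 unconditionally — «NE9 ⇐ the named binders».

WHAT IS PROVED (kernel, `[folklore]`-level bookkeeping with TYPE locators; 0 sorry, 0 def):
§1 **`termSize_ne9_and_fadingMemory_compCur_species_compProj_fedA3`** ((A) at `Dd.compCur Φ R′`, general projection `P`);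
§2 **`termSize_ne9_and_fadingMemory_compCur_species_margProj_fedA3`** ((B) at `Dd.compCur Φ R′`, read-out `P := margProj r A`).

References (TYPES only): [Balaban1987RG1] T. Bałaban, CMP **109** (1987) 249–301, (0.28)–(0.30) p. 258, (1.3) p. 260, (1.18)
p. 263, (1.20)–(1.22) p. 264, (3.30) p. 276, (3.37) p. 277, Lemma 4 (3.53)–(3.54) p. 280, (4.22) p. 286; [Balaban1988RG2Cluster]
T. Bałaban, CMP **116** (1988) 1–22, (1.21)–(1.29) pp. 7–8, (1.33)–(1.36) p. 9, (2.14)–(2.15) p. 15, Lemma 3 (2.38) p. 20.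
Summits-side NEW work (LEAN PLACEMENT RULE); imports leaf-05-g6's `NE9SizeFedCouplingSpeciesReadOut` (hence
`NE9SizeFedCouplingSpecies`) and this lineage's `NE9CurveFromBackgroundMapAdditive` (hence CUR-BG) BY NAME; modifies nothing; ROOT ∕
END files untouched (new faces beside the old).  Value = END-face bookkeeping (binder substitution), NOT summit progress.
-/

noncomputable section

namespace Summit.QuantumFields.BalabanUV.T4Continuum.NE9CurveFromBackgroundMapSpeciesEnd

open scoped BigOperators
open Metric Set
open Literature.Probability.LatticeModels
open Literature.MathematicalPhysics.QuantumFieldTheory.Balaban1983to89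
open Literature.MathematicalPhysics.QuantumFieldTheory.Balaban1983to89.T4OutputRate
open Literature.MathematicalPhysics.QuantumFieldTheory.Balaban1983to89.T4HistoryLipschitzRecursion
open Literature.MathematicalPhysics.QuantumFieldTheory.Balaban1983to89.T4HistoryLipschitzOuter
open Literature.MathematicalPhysics.QuantumFieldTheory.Balaban1983to89.T4HistoryLipschitzActivity
open Literature.MathematicalPhysics.QuantumFieldTheory.Balaban1983to89.T4HistoryLipschitzActivity (ClusterGeom)
open Literature.MathematicalPhysics.QuantumFieldTheory.Balaban1983to89.T4HistoryLipschitzSegment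
open Summit.QuantumFields.BalabanUV.T4Continuum.NE9Lemma1Counting
open Summit.QuantumFields.BalabanUV.T4Continuum.NE9Lemma1Gain
open Summit.QuantumFields.BalabanUV.T4Continuum.NE9Lemma1PieceClass
open Summit.QuantumFields.BalabanUV.T4Continuum.NE9Lemma1RemainderSpecies
open Summit.QuantumFields.BalabanUV.T4Continuum.NE9Lemma1CurveSpecies
open Summit.QuantumFields.BalabanUV.T4Continuum.NE9Lemma1KernelSpecies
open Summit.QuantumFields.BalabanUV.T4Continuum.NE9ComplexEncoding (doubleCarriers)
open Summit.QuantumFields.BalabanUV.T4Continuum.NE9MarginalProjection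
open Summit.QuantumFields.BalabanUV.T4Continuum.NE9MarginalProjectionEnd
open Summit.QuantumFields.BalabanUV.T4Continuum.NE9ChannelSum
open Summit.QuantumFields.BalabanUV.T4Continuum.NE9SizeFedCouplingSpecies
  (termSize_ne9_and_fadingMemory_species_compProj_fedA3)
open Summit.QuantumFields.BalabanUV.T4Continuum.NE9SizeFedCouplingSpeciesReadOut
  (termSize_ne9_and_fadingMemory_species_margProj_fedA3)
open Summit.QuantumFields.BalabanUV.T4Continuum.NE9CurveFromBackgroundMap
  (admissible_compCur cont_compCur lip_compCur room_compCur)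
open Summit.QuantumFields.BalabanUV.T4Continuum.NE9CurveFromBackgroundMapAdditive (pieceAdditiveOn_compCur)

variable {C₀ : Carriers} {E : Type} [NormedAddCommGroup E] [NormedSpace ℂ E]
  {ι α β γ δ α' β' γ' δ' Pt : Type} [DecidableEq δ] [DecidableEq δ']

variable (G : ClusterGeom (doubleCarriers C₀)) {Pot : Type*} [NormedAddCommGroup Pot] [NormedSpace ℂ Pot]

/-! ## §1 The `…_compProj` face (general projection `P`) at the assembled species, curves of Bałaban's shape -/

/-- **NE9 ∧ FADING MEMORY ∧ TERM SIZE AT THE ASSEMBLED SPECIES CHANNEL FOR CURVES OF BAŁABAN'S SHAPE, EVERY SLICE-CURVE BINDER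
PRODUCED, LEAF A3 SIZE-FED (kernel end-to-end; general projection `P`).**  leaf-05-g6's A3-FED-SPECIES (A)
`termSize_ne9_and_fadingMemory_species_compProj_fedA3` (p215986) APPLIED at the composite curve datum `D := Dd.compCur Φ R′` (slice
curve `τ ↦ Φ_X(τ • Dd.dir … t s σ)`, slice radius `R_X∕dirB`, chart radii `R′`) with its FIVE curve-side binders PRODUCED by name:
`hD := admissible_compCur hDd hpos0 hΦan hΦmaps`; (w19)'s `hAa := pieceAdditiveOn_compCur hDd hpos0 hdirC hdirB hΦan hΦmaps`; (c1)
`hcont := cont_compCur hDd hΦan hcont`; (c2) `hlip := lip_compCur hDd hΦan hΦmaps hclipd hcdir hℓ hlip` (so **`clipa := 4·clipd`**);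
(c3) `hroom := room_compCur hDd hΦan hΦmaps hΦ0 hcdir hℓ W` (Schwarz).  DISPLAYED (honest list): the RAY species' `Dd.Admissible ℓ
c_dir d₀`, `0 < dirB`, (w16)'s GLOBAL `hdirC`, the global size `hdirB`, A3-REM's (d1) `hcont` ∕ (d2) `hlip` (modulus
`clipd·(c_dir·ℓ k j·R_X)`), `hhalf`, `0 ≤ clipd`, `0 < c_dir`, `0 < ℓ` — TYPE [II] (1.21)–(1.25) p. 7; (Φ1) `Φ_X` analytic on
`ball 0 (R_X)` ([I] (3.37) p. 277), (Φ2) `MapsTo (Φ X) (ball 0 R_X) (ball 0 R′_X)` ([I] Lemma 4 (3.53) p. 280), (Φ3) `Φ_X 0 = 0`;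
species (a)'s level counts ON THE COMPOSITE FRAME at κ; the kernel species' `K.Admissible`, identification binders `hκ₁`∕`hR`∕`hdY`
(one κ₁, radii `R′`, one d_k(Y)), level counts at κ − w, (w23)-type additivity `hAb`, A3-KER's `0 ≤ λ` ∕ (C) ∕ (K-Lip) — VERBATIM;
`MF ⊆ analyticClass R′`; the projection quadruple `hPadd`∕`hPcomm`∕`hPinto`∕`hPsize` with cost `c`; A1∕A2 `hCup`; R1∕KP∕box∕(XZ)∕
(B0)∕(N′); `N j ≤ N̄`; `hqTb` with `clipa := 4·clipd`; `ω < 1`.  GONE vs p215986: `hD`, `hAa`, `hcont`∕`hlip`∕`hroom` at curve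
level.  Conclusion = p215986's, character for character.  Nothing of [I]–[II] asserted; that Bałaban's 𝐇_k, U_j(□₀, exp iB), U^c_j
and the §4 kernels meet the ray ∕ Φ ∕ kernel binders is O-NE9-1 ∕ O-NE9-5, NOT claimed; NE9 NOT PROVED; 0/9 unchanged.
[cite: Balaban1987RG1, (0.28)-(0.30) p.258, (1.3) p.260, (1.18) p.263, (3.37) p.277, (3.53)-(3.54) p.280, (4.22) p.286; Balaban1988RG2Cluster, (1.21)-(1.29) pp.7-8, (1.33)-(1.36) p.9, (2.14)-(2.15) p.15, Lemma 3 (2.38) p.20] -/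
theorem termSize_ne9_and_fadingMemory_compCur_species_compProj_fedA3
    {Dd : RemData C₀ E ι α β γ δ} {Φ : C₀.Dom → E → E} {R' : C₀.Dom → ℝ} {K : KerData C₀ E ι α' β' γ' δ' Pt}
    {ℓg ℓk gain : ℕ → ℕ → ℝ} {cdir cK δ₀ δ₁ w w0 c0 c1 d0 O1 cQa cQb : ℝ}
    {Ef : Functional (doubleCarriers C₀) E} {W : Set (ℕ → ℝ)}
    {Adm MF : Set (E → (doubleCarriers C₀).Dom → ℝ)}
    {P : (E → (doubleCarriers C₀).Dom → ℝ) → (E → (doubleCarriers C₀).Dom → ℝ)}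
    {Ψ : ℕ → ℝ → (ι → ℝ) → E → (doubleCarriers C₀).Dom → ℝ} {act : ℕ → ℝ → E → Pot → G.P → ℂ} {𝒜 : ℕ → Set Pot}
    {n : ℕ → ℝ → E → G.P → ℝ} {lip clip : ℕ → ℝ} {a d : G.P → ℝ} {δv : (doubleCarriers C₀).Dom → ℝ}
    {κ B lipbar clipbar qTbar ω c Nbar clipd lam : ℝ} {p₀ N : ℕ → ℝ}
    -- species (a) AT BAŁABAN'S SHAPE: the RAY datum's binders on the shift field (printed TYPE + numerals), `0 < dirB`, the GLOBAL
    -- ray pair, the background-map TYPE facts (Φ1)–(Φ3), the level counts on the composite frame, A3-REM's ray-level (d1)∕(d2)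
    (hDd : Dd.Admissible ℓg cdir d0) (hpos0 : ∀ k s y a' b x, 0 < Dd.dirB k s y a' b x)
    (hdirC : ∀ k s y a' b x, Continuous fun p : ℂ × (δ → ℝ) × (δ → ℂ) => Dd.dir k s y a' b x p.1 p.2.1 p.2.2)
    (hdirB : ∀ k s y a' b x t s' σ', ‖Dd.dir k s y a' b x t s' σ'‖ ≤ Dd.dirB k s y a' b x)
    (hΦan : ∀ X, DifferentiableOn ℂ (Φ X) (ball 0 (Dd.R X))) (hΦmaps : ∀ X, MapsTo (Φ X) (ball 0 (Dd.R X)) (ball 0 (R' X)))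
    (hΦ0 : ∀ X, Φ X 0 = 0) (hℓ : ∀ k j, 0 < ℓg k j)
    (hLa : LevelCountsG (Dd.compCur Φ R').toC.frame κ (Dd.compCur Φ R').κ₁ O1 cQa (fun k j => ℓg k j ^ 5) (agePow ω))
    (hclipd : 0 ≤ clipd) (hcdir : 0 < cdir) (hhalf : ∀ k j, cdir * ℓg k j < 1 / 2)
    (hcont : ∀ (k : ℕ) (s : ℕ → ℝ) (y : ι) (a' : α) (b : β) (x : (doubleCarriers C₀).Dom),
      ContinuousOn (fun p : ℂ × ((δ → ℝ) × (δ → ℂ)) => Dd.dir k s y a' b x p.1 p.2.1 p.2.2)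
        (sphere (0:ℂ) (Dd.r k) ×ˢ {q | OnContour Dd.κ₁ (Dd.cubes k y a' b) q.1 q.2}))
    (hlip : ∀ g ∈ W, ∀ g' ∈ W, ∀ (k : ℕ) (y : ι), ∀ a' ∈ Dd.S0 k y, ∀ b ∈ Dd.SY k y a', ∀ (j : ℕ), ∀ x ∈ Dd.src k y a' j,
      ∀ t ∈ sphere (0:ℂ) (Dd.r k), ∀ (s' : δ → ℝ) (σ' : δ → ℂ), OnContour Dd.κ₁ (Dd.cubes k y a' b) s' σ' →
        ‖Dd.dir k g y a' b x t s' σ' - Dd.dir k g' y a' b x t s' σ'‖ ≤ clipd * (cdir * ℓg k j * Dd.R x.1) * |g k - g' k|)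
    -- species (b): the kernel datum and its binders VERBATIM ((A)∕(B)), on the SAME κ₁ ∕ radii R′ ∕ output geometry
    (hK : K.Admissible ℓk gain cK δ₀ δ₁ w w0 c0 c1 d0) (hκ₁ : K.κ₁ = (Dd.compCur Φ R').κ₁) (hR : K.R = (Dd.compCur Φ R').R)
    (hdY : K.toC.frame.dY = (Dd.compCur Φ R').toC.frame.dY)
    (hLb : LevelCountsG K.toC.frame (κ - w) K.κ₁ O1 cQb gain (agePow ω))
    (hAb : PieceAdditiveOn (analyticClass K.R) K.toC) (hlam : 0 ≤ lam)
    (hkerC : ∀ (k : ℕ) (s : ℕ → ℝ) (y : ι) (a : α') (b : β') (x : (doubleCarriers C₀).Dom), ∀ p ∈ K.pts k y a,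
      ∀ q ∈ K.pts k y a, ∀ F : E → ℂ, DifferentiableOn ℂ F (ball 0 (K.R x.1)) →
        Continuous fun wv : ℂ × (δ' → ℝ) × (δ' → ℂ) => K.ker k s y a b x wv.1 wv.2.1 wv.2.2 p q F)
    (hkerL : ∀ g ∈ W, ∀ g' ∈ W, ∀ (k : ℕ) (y : ι), ∀ a ∈ K.S0 k y, ∀ b ∈ K.SY k y a, ∀ (j : ℕ), ∀ x ∈ K.src k y a j,
      ∀ t ∈ sphere (0:ℂ) (K.r k), ∀ (s' : δ' → ℝ) (σ' : δ' → ℂ), OnContour K.κ₁ (K.cubes k y a b) s' σ' →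
        ∀ p ∈ K.pts k y a, ∀ q ∈ K.pts k y a, ∀ (F : E → ℂ) (M : ℝ),
          DifferentiableOn ℂ F (ball 0 (K.R x.1)) → (∀ z ∈ ball (0:E) (K.R x.1), ‖F z‖ ≤ M) →
            ‖K.ker k g y a b x t s' σ' p q F - K.ker k g' y a b x t s' σ' p q F‖ ≤
              cK * lam * M * gain k j * K.ρd p q ^ K.m * Real.exp (-(δ₀ * (K.dX x.1 p + K.dX x.1 q))) * |g k - g' k|)
    (hO1 : 0 ≤ O1) (hcQa : 0 ≤ cQa) (hcQb : 0 ≤ cQb) (hMF : MF ⊆ analyticClass (Dd.compCur Φ R').R)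
    -- the face's binders, verbatim (p215986), at 𝒯 := cpieceChannel (Dd.compCur Φ R′).toC + cpieceChannel K.toC
    (ρ : ℕ → (ι → ℝ) → Pot) (U₀ : E) (explZ : ℕ → E → (doubleCarriers C₀).Dom → ℝ) (h0 : ScaleZeroFree Ef W)
    (hAdm : AdmissibleTerms Ef W Adm) (hres : AdmRestrict Adm)
    (hPadd : ProjAdditive Adm P) (hPcomm : ProjScaleComm Adm P) (hPinto : ProjInto Adm MF P) (hPsize : ProjSize Adm P κ c)
    (hc : 0 ≤ c)
    (hfac : Factorises Ef W (compProj (cpieceChannel (Dd.compCur Φ R').toC + cpieceChannel K.toC) P) Ψ)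
    (hclip0 : ∀ k, 0 ≤ clip k)
    (hCup : ∀ g ∈ W, ∀ g' ∈ W, ∀ (k : ℕ) (U : E) (X : (doubleCarriers C₀).Dom), (doubleCarriers C₀).scale X = k + 1 →
      ∀ Q ∈ 𝒜 k, ∀ γ' ∈ G.vol X,
      ‖act k (g k) U Q γ'‖ ≤ n k (g' k) U γ' ∧
        ‖act k (g k) U Q γ' - act k (g' k) U Q γ'‖ ≤ clip k * |g k - g' k| * n k (g' k) U γ')
    (hreprV : ∀ (k : ℕ) (s : ℝ) (Q : ι → ℝ) (U : E) (X : (doubleCarriers C₀).Dom),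
      Ψ k s Q U X = (G.newTerm act k s U X (ρ k Q)).re - (G.newTerm act k s U₀ X (ρ k Q)).re + explZ k U X)
    (hclipb : ∀ k, clip k ≤ clipbar) (hNb : ∀ j, N j ≤ Nbar)
    (hqTb : (64 * (4 * clipd) * cQa + lam * cQb) * ((1 + c) * Nbar) * (1 - ω)⁻¹ ≤ qTbar)
    (hKP : TwoPointKP G W act 𝒜 n lip a d) (hdec : G.DecayExtract δv d) (hpin : G.PinBudget a δv (fun _ => B) κ)
    (hρ : ∀ (k : ℕ) (Q Q' : ι → ℝ) (M : ℝ),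
      (∀ y, |Q y - Q' y| ≤ weightOf (Dd.compCur Φ R').toC.frame (Dd.compCur Φ R').κ₁ d0 O1
        ((Dd.compCur Φ R').Kp cdir + K.Kp cK w0 c0 c1) k y * M) → ‖ρ k Q - ρ k Q'‖ ≤ M)
    (hexplZ : ∀ (k : ℕ) (U : E) (X : (doubleCarriers C₀).Dom), (doubleCarriers C₀).scale X = k + 1 →
      |explZ k U X| ≤ Real.exp (-(κ * (doubleCarriers C₀).d X)) * p₀ k)
    (hbase : ∀ g ∈ W, ∀ (U : E) (X : (doubleCarriers C₀).Dom), (doubleCarriers C₀).scale X = 0 →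
      |Ef g U X| ≤ Real.exp (-(κ * (doubleCarriers C₀).d X)) * N 0)
    (hNsucc : ∀ j, p₀ j + 2 * B ≤ N (j + 1)) (hNnn : ∀ j, 0 ≤ N j)
    (hbox : ∀ (k : ℕ) (Q : ι → ℝ),
      (∀ y, |Q y| ≤ weightOf (Dd.compCur Φ R').toC.frame (Dd.compCur Φ R').κ₁ d0 O1
        ((Dd.compCur Φ R').Kp cdir + K.Kp cK w0 c0 c1) k y *
          sizeRadius (fun k j => (1 + c) * (tauOfG cQa (agePow ω) + tauOfG cQb (agePow ω)) k j) N k) → ρ k Q ∈ 𝒜 k)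
    (hB : 0 ≤ B) (hlipb : ∀ k, lip k ≤ lipbar) (hω : 0 ≤ ω) (hω1 : ω < 1)
    (hpos : 0 < ω + 8 * lipbar * B * ((1 + c) * (cQa + cQb))) :
    TermSize Ef W κ N ∧
      NE9 Ef W κ (prodModuli (8 * clipbar * B + 8 * lipbar * B * qTbar)
        fun _ => ω + 8 * lipbar * B * ((1 + c) * (cQa + cQb))) ∧
        FadingMemory ((8 * clipbar * B + 8 * lipbar * B * qTbar) / (ω + 8 * lipbar * B * ((1 + c) * (cQa + cQb))))
          (ω + 8 * lipbar * B * ((1 + c) * (cQa + cQb)))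
          (prodModuli (8 * clipbar * B + 8 * lipbar * B * qTbar)
            fun _ => ω + 8 * lipbar * B * ((1 + c) * (cQa + cQb))) :=
  termSize_ne9_and_fadingMemory_species_compProj_fedA3 G (admissible_compCur hDd hpos0 hΦan hΦmaps) hℓ hLa
    (pieceAdditiveOn_compCur hDd hpos0 hdirC hdirB hΦan hΦmaps) (by positivity) hcdir hhalf (cont_compCur hDd hΦan hcont)
    (lip_compCur hDd hΦan hΦmaps hclipd hcdir hℓ hlip) (room_compCur hDd hΦan hΦmaps hΦ0 hcdir hℓ W) hK hκ₁ hR hdY hLb hAb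
    hlam hkerC hkerL hO1 hcQa hcQb hMF ρ U₀ explZ h0 hAdm hres hPadd hPcomm hPinto hPsize hc hfac hclip0 hCup hreprV hclipb hNb
    hqTb hKP hdec hpin hρ hexplZ hbase hNsucc hNnn hbox hB hlipb hω hω1 hpos

/-! ## §2 The READ-OUT face (`P := margProj r A`) at the assembled species, curves of Bałaban's shape -/

/-- **THE SAME AT THE READ-OUT PROJECTION `P := margProj r A` (kernel end-to-end).**  leaf-05-g6's read-out twin (B)
`termSize_ne9_and_fadingMemory_species_margProj_fedA3` (p216114) APPLIED at `D := Dd.compCur Φ R′` with the same five producers;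
RO ∕ AW binders `hrA hr0 hrs hA hcr haA` and `hPinto : ProjInto Adm MF (margProj r A)` VERBATIM ([I] (1.3) ∕ (1.20)–(1.22)),
`c := cr·a_A`; otherwise §1's displayed list.  Conclusion = p216114's (= END-M `…_margProj`'s at 𝒯 := cpieceChannel D.toC +
cpieceChannel K.toC, τ̄ := cQ_(a) + cQ_(b)), character for character, with `clipa := 4·clipd` inside the displayed `hqTb` only.
[cite: Balaban1987RG1, (0.28)-(0.29) p.258, (1.3) p.260, (1.18) p.263, (1.20)-(1.22) p.264, (3.37) p.277, (3.53)-(3.54) p.280, (4.22) p.286; Balaban1988RG2Cluster, (1.21)-(1.29) pp.7-8, (1.33)-(1.36) p.9, (2.14)-(2.15) p.15] -/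
theorem termSize_ne9_and_fadingMemory_compCur_species_margProj_fedA3
    {Dd : RemData C₀ E ι α β γ δ} {Φ : C₀.Dom → E → E} {R' : C₀.Dom → ℝ} {K : KerData C₀ E ι α' β' γ' δ' Pt}
    {ℓg ℓk gain : ℕ → ℕ → ℝ} {cdir cK δ₀ δ₁ w w0 c0 c1 d0 O1 cQa cQb : ℝ}
    {Ef : Functional (doubleCarriers C₀) E} {W : Set (ℕ → ℝ)}
    {Adm MF : Set (E → (doubleCarriers C₀).Dom → ℝ)}
    {r : ℕ → (E → (doubleCarriers C₀).Dom → ℝ) → ℝ} {A : E → (doubleCarriers C₀).Dom → ℝ}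
    {Ψ : ℕ → ℝ → (ι → ℝ) → E → (doubleCarriers C₀).Dom → ℝ} {act : ℕ → ℝ → E → Pot → G.P → ℂ} {𝒜 : ℕ → Set Pot}
    {n : ℕ → ℝ → E → G.P → ℝ} {lip clip : ℕ → ℝ} {a d : G.P → ℝ} {δv : (doubleCarriers C₀).Dom → ℝ}
    {κ B lipbar clipbar qTbar ω cr aA Nbar clipd lam : ℝ} {p₀ N : ℕ → ℝ}
    -- species (a) AT BAŁABAN'S SHAPE: the RAY datum's binders on the shift field (printed TYPE + numerals), `0 < dirB`, the GLOBAL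
    -- ray pair, the background-map TYPE facts (Φ1)–(Φ3), the level counts on the composite frame, A3-REM's ray-level (d1)∕(d2)
    (hDd : Dd.Admissible ℓg cdir d0) (hpos0 : ∀ k s y a' b x, 0 < Dd.dirB k s y a' b x)
    (hdirC : ∀ k s y a' b x, Continuous fun p : ℂ × (δ → ℝ) × (δ → ℂ) => Dd.dir k s y a' b x p.1 p.2.1 p.2.2)
    (hdirB : ∀ k s y a' b x t s' σ', ‖Dd.dir k s y a' b x t s' σ'‖ ≤ Dd.dirB k s y a' b x)
    (hΦan : ∀ X, DifferentiableOn ℂ (Φ X) (ball 0 (Dd.R X))) (hΦmaps : ∀ X, MapsTo (Φ X) (ball 0 (Dd.R X)) (ball 0 (R' X)))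
    (hΦ0 : ∀ X, Φ X 0 = 0) (hℓ : ∀ k j, 0 < ℓg k j)
    (hLa : LevelCountsG (Dd.compCur Φ R').toC.frame κ (Dd.compCur Φ R').κ₁ O1 cQa (fun k j => ℓg k j ^ 5) (agePow ω))
    (hclipd : 0 ≤ clipd) (hcdir : 0 < cdir) (hhalf : ∀ k j, cdir * ℓg k j < 1 / 2)
    (hcont : ∀ (k : ℕ) (s : ℕ → ℝ) (y : ι) (a' : α) (b : β) (x : (doubleCarriers C₀).Dom),
      ContinuousOn (fun p : ℂ × ((δ → ℝ) × (δ → ℂ)) => Dd.dir k s y a' b x p.1 p.2.1 p.2.2)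
        (sphere (0:ℂ) (Dd.r k) ×ˢ {q | OnContour Dd.κ₁ (Dd.cubes k y a' b) q.1 q.2}))
    (hlip : ∀ g ∈ W, ∀ g' ∈ W, ∀ (k : ℕ) (y : ι), ∀ a' ∈ Dd.S0 k y, ∀ b ∈ Dd.SY k y a', ∀ (j : ℕ), ∀ x ∈ Dd.src k y a' j,
      ∀ t ∈ sphere (0:ℂ) (Dd.r k), ∀ (s' : δ → ℝ) (σ' : δ → ℂ), OnContour Dd.κ₁ (Dd.cubes k y a' b) s' σ' →
        ‖Dd.dir k g y a' b x t s' σ' - Dd.dir k g' y a' b x t s' σ'‖ ≤ clipd * (cdir * ℓg k j * Dd.R x.1) * |g k - g' k|)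
    -- species (b): the kernel datum and its binders VERBATIM ((A)∕(B)), on the SAME κ₁ ∕ radii R′ ∕ output geometry
    (hK : K.Admissible ℓk gain cK δ₀ δ₁ w w0 c0 c1 d0) (hκ₁ : K.κ₁ = (Dd.compCur Φ R').κ₁) (hR : K.R = (Dd.compCur Φ R').R)
    (hdY : K.toC.frame.dY = (Dd.compCur Φ R').toC.frame.dY)
    (hLb : LevelCountsG K.toC.frame (κ - w) K.κ₁ O1 cQb gain (agePow ω))
    (hAb : PieceAdditiveOn (analyticClass K.R) K.toC) (hlam : 0 ≤ lam)
    (hkerC : ∀ (k : ℕ) (s : ℕ → ℝ) (y : ι) (a : α') (b : β') (x : (doubleCarriers C₀).Dom), ∀ p ∈ K.pts k y a,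
      ∀ q ∈ K.pts k y a, ∀ F : E → ℂ, DifferentiableOn ℂ F (ball 0 (K.R x.1)) →
        Continuous fun wv : ℂ × (δ' → ℝ) × (δ' → ℂ) => K.ker k s y a b x wv.1 wv.2.1 wv.2.2 p q F)
    (hkerL : ∀ g ∈ W, ∀ g' ∈ W, ∀ (k : ℕ) (y : ι), ∀ a ∈ K.S0 k y, ∀ b ∈ K.SY k y a, ∀ (j : ℕ), ∀ x ∈ K.src k y a j,
      ∀ t ∈ sphere (0:ℂ) (K.r k), ∀ (s' : δ' → ℝ) (σ' : δ' → ℂ), OnContour K.κ₁ (K.cubes k y a b) s' σ' →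
        ∀ p ∈ K.pts k y a, ∀ q ∈ K.pts k y a, ∀ (F : E → ℂ) (M : ℝ),
          DifferentiableOn ℂ F (ball 0 (K.R x.1)) → (∀ z ∈ ball (0:E) (K.R x.1), ‖F z‖ ≤ M) →
            ‖K.ker k g y a b x t s' σ' p q F - K.ker k g' y a b x t s' σ' p q F‖ ≤
              cK * lam * M * gain k j * K.ρd p q ^ K.m * Real.exp (-(δ₀ * (K.dX x.1 p + K.dX x.1 q))) * |g k - g' k|)
    (hO1 : 0 ≤ O1) (hcQa : 0 ≤ cQa) (hcQb : 0 ≤ cQb) (hMF : MF ⊆ analyticClass (Dd.compCur Φ R').R)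
    -- the face's binders (END-M `…_margProj`, p216114), at 𝒯 := cpieceChannel (Dd.compCur Φ R′).toC + cpieceChannel K.toC
    (ρ : ℕ → (ι → ℝ) → Pot) (U₀ : E) (explZ : ℕ → E → (doubleCarriers C₀).Dom → ℝ) (h0 : ScaleZeroFree Ef W)
    (hAdm : AdmissibleTerms Ef W Adm) (hres : AdmRestrict Adm)
    (hrA : ReadAdditive Adm r) (hr0 : ReadZero r) (hrs : ReadSize Adm r κ cr) (hA : DirSize A κ aA) (hcr : 0 ≤ cr)
    (haA : 0 ≤ aA) (hPinto : ProjInto Adm MF (margProj r A))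
    (hfac : Factorises Ef W (compProj (cpieceChannel (Dd.compCur Φ R').toC + cpieceChannel K.toC) (margProj r A)) Ψ)
    (hclip0 : ∀ k, 0 ≤ clip k)
    (hCup : ∀ g ∈ W, ∀ g' ∈ W, ∀ (k : ℕ) (U : E) (X : (doubleCarriers C₀).Dom), (doubleCarriers C₀).scale X = k + 1 →
      ∀ Q ∈ 𝒜 k, ∀ γ' ∈ G.vol X,
      ‖act k (g k) U Q γ'‖ ≤ n k (g' k) U γ' ∧
        ‖act k (g k) U Q γ' - act k (g' k) U Q γ'‖ ≤ clip k * |g k - g' k| * n k (g' k) U γ')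
    (hreprV : ∀ (k : ℕ) (s : ℝ) (Q : ι → ℝ) (U : E) (X : (doubleCarriers C₀).Dom),
      Ψ k s Q U X = (G.newTerm act k s U X (ρ k Q)).re - (G.newTerm act k s U₀ X (ρ k Q)).re + explZ k U X)
    (hclipb : ∀ k, clip k ≤ clipbar) (hNb : ∀ j, N j ≤ Nbar)
    (hqTb : (64 * (4 * clipd) * cQa + lam * cQb) * ((1 + cr * aA) * Nbar) * (1 - ω)⁻¹ ≤ qTbar)
    (hKP : TwoPointKP G W act 𝒜 n lip a d) (hdec : G.DecayExtract δv d) (hpin : G.PinBudget a δv (fun _ => B) κ)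
    (hρ : ∀ (k : ℕ) (Q Q' : ι → ℝ) (M : ℝ),
      (∀ y, |Q y - Q' y| ≤ weightOf (Dd.compCur Φ R').toC.frame (Dd.compCur Φ R').κ₁ d0 O1
        ((Dd.compCur Φ R').Kp cdir + K.Kp cK w0 c0 c1) k y * M) → ‖ρ k Q - ρ k Q'‖ ≤ M)
    (hexplZ : ∀ (k : ℕ) (U : E) (X : (doubleCarriers C₀).Dom), (doubleCarriers C₀).scale X = k + 1 →
      |explZ k U X| ≤ Real.exp (-(κ * (doubleCarriers C₀).d X)) * p₀ k)
    (hbase : ∀ g ∈ W, ∀ (U : E) (X : (doubleCarriers C₀).Dom), (doubleCarriers C₀).scale X = 0 →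
      |Ef g U X| ≤ Real.exp (-(κ * (doubleCarriers C₀).d X)) * N 0)
    (hNsucc : ∀ j, p₀ j + 2 * B ≤ N (j + 1)) (hNnn : ∀ j, 0 ≤ N j)
    (hbox : ∀ (k : ℕ) (Q : ι → ℝ),
      (∀ y, |Q y| ≤ weightOf (Dd.compCur Φ R').toC.frame (Dd.compCur Φ R').κ₁ d0 O1
        ((Dd.compCur Φ R').Kp cdir + K.Kp cK w0 c0 c1) k y *
          sizeRadius (fun k j => (1 + cr * aA) * (tauOfG cQa (agePow ω) + tauOfG cQb (agePow ω)) k j) N k) → ρ k Q ∈ 𝒜 k)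
    (hB : 0 ≤ B) (hlipb : ∀ k, lip k ≤ lipbar) (hω : 0 ≤ ω) (hω1 : ω < 1)
    (hpos : 0 < ω + 8 * lipbar * B * ((1 + cr * aA) * (cQa + cQb))) :
    TermSize Ef W κ N ∧
      NE9 Ef W κ (prodModuli (8 * clipbar * B + 8 * lipbar * B * qTbar)
        fun _ => ω + 8 * lipbar * B * ((1 + cr * aA) * (cQa + cQb))) ∧
        FadingMemory ((8 * clipbar * B + 8 * lipbar * B * qTbar) / (ω + 8 * lipbar * B * ((1 + cr * aA) * (cQa + cQb))))
          (ω + 8 * lipbar * B * ((1 + cr * aA) * (cQa + cQb)))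
          (prodModuli (8 * clipbar * B + 8 * lipbar * B * qTbar)
            fun _ => ω + 8 * lipbar * B * ((1 + cr * aA) * (cQa + cQb))) :=
  termSize_ne9_and_fadingMemory_species_margProj_fedA3 G (admissible_compCur hDd hpos0 hΦan hΦmaps) hℓ hLa
    (pieceAdditiveOn_compCur hDd hpos0 hdirC hdirB hΦan hΦmaps) (by positivity) hcdir hhalf (cont_compCur hDd hΦan hcont)
    (lip_compCur hDd hΦan hΦmaps hclipd hcdir hℓ hlip) (room_compCur hDd hΦan hΦmaps hΦ0 hcdir hℓ W) hK hκ₁ hR hdY hLb hAb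
    hlam hkerC hkerL hO1 hcQa hcQb hMF ρ U₀ explZ h0 hAdm hres hrA hr0 hrs hA hcr haA hPinto hfac hclip0 hCup hreprV hclipb hNb
    hqTb hKP hdec hpin hρ hexplZ hbase hNsucc hNnn hbox hB hlipb hω hω1 hpos

end Summit.QuantumFields.BalabanUV.T4Continuum.NE9CurveFromBackgroundMapSpeciesEnd

end
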